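import Mathlib
import Summits.PneNP.PneNP.Theorems.PstarExpanding74Exist
import Summits.PneNP.PneNP.Theorems.PstarSubInstance
import Summits.PneNP.PneNP.Theorems.PstarSAHeadline
import Summits.PneNP.PneNP.Theorems.PstarTypedSASDPLinearLevel
import Summits.PneNP.PneNP.Theorems.PstarSA2Blind

/-!
# Supply for the SA+SDP hubs: expanding typed `P⋆` instances with simple overlaps at ratio `7/4` (w23d closed; k = 4)

FRONTIER range-avoidance ladder (cell `pnp-ideate`, residue w23d of ROUNDS 21–23; restricted-model combinatorics — nothing here
bears on `P` versus `NP`).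

ALTERATION on top of `PstarExpanding74Exist.exists_good74`: take an outcome `ω` of the R21 typed model that is not `bad74` at radius
`N/(3L⁸)` and has at most `80K²` output pairs sharing two variables, and delete the larger member of each such pair
(`delSet`, `alter ω = PstarSubInstance.restrictTo (inst ω) (univ ∖ delSet ω)`).  The altered instance is pure, typed,
`(r, 7/4)`-boundary expanding (inherited, `PstarSubInstance.boundaryExpandingQ_restrictTo`) and has SIMPLE OVERLAPS, on
`m' ≥ K·N − 80K²` outputs; with `K = 2C + 3` and `N > 80K²` this is still `> max (C·n, n)` for `n = 2N`.  Hence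

* `expandingTypedExist74`: at every linear stretch `C`, typed pure `P⋆` instances with `BoundaryExpandingQ 7 4 (n/c)` AND
  `SimpleOverlap` (`c = 6·(1944(2C+3))⁸`);
* **`expandingTypedExist : PstarSAHeadline.ExpandingTypedExist`** — the ROUND-21 conjecture def (WITH simple overlaps) closed by
  name (`7/4 ⇒ 3/2` by `boundaryExpanding_of_Q74`);
* **`saSDPLinearBlind`** — the SA+SDP linear-level blindness headline: by T21.1c `PstarTypedSASDPLinearLevel.typedSASDPLinearLevel`
  fed with this supply, at every linear stretch some pure `P⋆` instance with `m ≥ C·n` outputs has non-range points while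
  Sherali–Adams WITH the PSD degree-2 moment matrix is feasible at level `n/c` for EVERY target.
SCOPE (referee ask (3)): arity `k = 4` only — the `k = 6` corollary of T23.3 needs ratio `15/4` (a separate re-run, w23e).
-/

set_option linter.dupNamespace false -- `Summit.PneNP.PneNP.…`: summit = sub-problem name (D-0017 single-conjunct layout)

open Finset Literature.Computability.Complexity
open Summit.PneNP.PneNP.Theorems.PstarTyped (Typed)
open Summit.PneNP.PneNP.Theorems.PstarSALevel (varSet BoundaryExpanding SimpleOverlap)
open Summit.PneNP.PneNP.Theorems.PstarSASDPLevel (BoundaryExpandingQ SASDPFeasible TypedSASDPLinearLevel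
  boundaryExpanding_of_Q74)
open Summit.PneNP.PneNP.Theorems.PstarExpandingModel (DPair Outcome inst isPure_inst typed_inst)
open Summit.PneNP.PneNP.Theorems.PstarExpanding74Count (bad74 boundaryExpandingQ74_of_not_bad74)
open Summit.PneNP.PneNP.Theorems.PstarExpanding74Exist (exists_good74)
open Summit.PneNP.PneNP.Theorems.PstarOverlapCount (ovl)
open Summit.PneNP.PneNP.Theorems.PstarSubInstance

namespace Summit.PneNP.PneNP.Theorems.PstarExpanding74Supply

variable {N m : ℕ}

/-! ## The alteration -/

/-- The outputs to delete: the larger member of every output pair sharing two variables. -/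
def delSet (ω : Outcome N m) : Finset (Fin m) := (ovl ω).image Prod.snd

/-- At most one deletion per offending pair. -/
theorem card_delSet_le (ω : Outcome N m) : (delSet ω).card ≤ (ovl ω).card := card_image_le

/-- The kept outputs pairwise share at most one variable. -/
theorem pairwise_keep (ω : Outcome N m) :
    ∀ j ∈ univ \ delSet ω, ∀ j' ∈ univ \ delSet ω, j ≠ j' → (varSet (inst ω) j ∩ varSet (inst ω) j').card ≤ 1 :=
  pairwise_of_sdiff fun j j' hlt h2 =>
    mem_image.2 ⟨(j, j'), by unfold PstarOverlapCount.ovl; exact mem_filter.2 ⟨mem_univ _, hlt, h2⟩, rfl⟩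

/-- **The altered instance**: keep the outputs outside `delSet ω`. -/
def alter (ω : Outcome N m) : LocalMap 4 (N + N) (univ \ delSet ω).card := restrictTo (inst ω) (univ \ delSet ω)

/-- The altered instance of a good outcome: pure, typed, `(r, 7/4)`-expanding, simple overlaps. -/
theorem alter_props (ω : Outcome N m) {r : ℕ} (hgood : ¬bad74 r ω) :
    (alter ω).IsPure xorAndPred ∧ Typed (alter ω) ∧ BoundaryExpandingQ 7 4 r (alter ω) ∧ SimpleOverlap (alter ω) :=
  ⟨isPure_restrictTo (isPure_inst ω) _, typed_restrictTo (typed_inst ω) _,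
    boundaryExpandingQ_restrictTo (boundaryExpandingQ74_of_not_bad74 r ω hgood) _, simpleOverlap_restrictTo (pairwise_keep ω)⟩

/-- The altered instance keeps at least `m − #ovl ω` outputs. -/
theorem le_card_keep (ω : Outcome N m) : m - (ovl ω).card ≤ (univ \ delSet ω).card := by
  rw [card_univ_sdiff]
  have := card_delSet_le ω
  omega

/-! ## The supply theorems -/

/-- **Expanding typed instances with simple overlaps at ratio `7/4`, at every linear stretch.** -/
theorem expandingTypedExist74 : ∀ C : ℕ, ∃ c : ℕ, 0 < c ∧ ∀ N₀ : ℕ, ∃ n, N₀ ≤ n ∧ ∃ m, n < m ∧ C * n ≤ m ∧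
    ∃ I : LocalMap 4 n m, I.IsPure xorAndPred ∧ Typed I ∧ BoundaryExpandingQ 7 4 (n / c) I ∧ SimpleOverlap I := by
  intro C
  set K := 2 * C + 3 with hK
  set L := 1944 * K with hLdef
  have hL1 : 1 ≤ L := by omega
  refine ⟨6 * L ^ 8, by positivity, fun N₀ => ?_⟩
  set N := max (max N₀ 2) (80 * K ^ 2 + 1) with hNdef
  have hN2 : 2 ≤ N := (le_max_right _ _).trans (le_max_left _ _)
  have hN0 : N₀ ≤ N := (le_max_left _ _).trans (le_max_left _ _)
  have hNK : 80 * K ^ 2 + 1 ≤ N := le_max_right _ _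
  obtain ⟨ω, hgood, hovl⟩ := exists_good74 K L N (K * N) le_rfl hL1 hN2 le_rfl
  have hkeep := le_card_keep ω
  set m' := (univ \ delSet ω).card with hm'
  have hbig : N + N < m' ∧ C * (N + N) ≤ m' := by
    set P := K * N with hP
    set Q := C * N with hQ
    have e1 : P = 2 * Q + 3 * N := by rw [hP, hQ, hK]; ring
    have e2 : C * (N + N) = 2 * Q := by rw [hQ]; ring
    rw [e2]
    set K2 := K ^ 2 with hK2
    set o := (ovl ω).card with ho
    constructor <;> omega
  obtain ⟨hP, hT, hB, hS⟩ := alter_props ω hgood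
  refine ⟨N + N, by omega, m', hbig.1, hbig.2, alter ω, hP, hT, ?_, hS⟩
  have hdiv : (N + N) / (6 * L ^ 8) = N / (3 * L ^ 8) := by
    rw [show N + N = 2 * N by ring, show 6 * L ^ 8 = 2 * (3 * L ^ 8) by ring]
    exact Nat.mul_div_mul_left N (3 * L ^ 8) (by norm_num)
  rw [hdiv]
  exact hB

/-- **`ExpandingTypedExist` (the ROUND-21 conjecture def, with simple overlaps) by name.** -/
theorem expandingTypedExist : PstarSAHeadline.ExpandingTypedExist := by
  intro C
  obtain ⟨c, hc, h⟩ := expandingTypedExist74 C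
  refine ⟨c, hc, fun N₀ => ?_⟩
  obtain ⟨n, hn, m, hnm, hCm, I, hP, hT, hB, hS⟩ := h N₀
  exact ⟨n, hn, m, hnm, hCm, I, hP, hT, boundaryExpanding_of_Q74 hB, hS⟩

/-- **The SA+SDP linear-level blindness headline.**  At every linear stretch `C` there is `c > 0` such that for infinitely many `n`
some pure-`P⋆` instance with `C·n ≤ m` outputs has a point outside its range and yet Sherali–Adams of level `n / c` TOGETHER WITH
the positive-semidefinite degree-2 moment matrix (`PstarSASDPLevel.SASDPFeasible`) is feasible for EVERY target. -/
def SASDPLinearBlind : Prop :=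
  ∀ C : ℕ, ∃ c : ℕ, 0 < c ∧ ∀ N : ℕ, ∃ n, N ≤ n ∧ ∃ m, C * n ≤ m ∧
    ∃ I : LocalMap 4 n m, I.IsPure xorAndPred ∧ (∃ y, y ∉ I.range) ∧ ∀ y, SASDPFeasible (n / c) I y

/-- **The SA+SDP headline holds** (T21.1c `typedSASDPLinearLevel` + the `7/4` supply with simple overlaps).  Restricted-model
theorem of the range-avoidance ladder (arity `4`, linear stretch); it says nothing about `P` versus `NP`. -/
theorem saSDPLinearBlind : SASDPLinearBlind := by
  intro C
  obtain ⟨c₁, hc₁, h1⟩ := PstarTypedSASDPLinearLevel.typedSASDPLinearLevel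
  obtain ⟨c₀, hc₀, h0⟩ := expandingTypedExist74 C
  refine ⟨c₀ * c₁, by positivity, fun N₀ => ?_⟩
  obtain ⟨n, hn, m, hnm, hCm, I, hP, hT, hB, hS⟩ := h0 N₀
  refine ⟨n, hn, m, hCm, I, hP, PstarSA2Blind.exists_not_mem_range I hnm, fun y => ?_⟩
  have := h1 n m (n / c₀) I hP hT hB hS y
  rwa [Nat.div_div_eq_div_mul] at this

end Summit.PneNP.PneNP.Theorems.PstarExpanding74Supply
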